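import Literature.Probability.RandomPlanarGeometry.SAWRatioLimit
import Literature.Probability.RandomPlanarGeometry.SAWBridgePatternRatio
import Literature.Probability.RandomPlanarGeometry.SAWBridgeUpperBound
import Literature.Probability.RandomPlanarGeometry.HammersleyWelshBound
import Mathlib.Analysis.SpecialFunctions.Pow.Real
import HarnessLib

/-!
# A Kesten-type rate for the two-step bridge ratio: `-K N^{-1/3} ≤ b_{N+2}/b_N - μ² ≤ K N^{-1/4}`

Topic `Literature/Probability/RandomPlanarGeometry` (continues `SAWBridgePatternRatio.lean`,
`SAWKestenRatioExplicit.lean`). Madras–Slade, *The Self-Avoiding Walk* (1993): Theorem 7.3.2(b) for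
bridges (tree: `Zd.MadrasSlade1993_thm732b`, `∃ D`, eventually) and (7.3.13) `b_{N+2}/b_N → μ²`
(tree: `Zd.MadrasSlade1993_eq7313`) carry NO rate in print; §7.5 (p. 255) prints Kesten's 1963 rates
only for `c_N` ((7.5.1)) and `c_N(0,x)` ((7.5.2): `-K N^{-1/3} ≤ … ≤ K N^{-1/4}`). Here the
quantitative Lemma 7.3.1 (tree: `kesten_iter_forward/backward`, `kesten_prod_ge/le`) is run for
BRIDGES with the envelope `e^{-c√n} μ^n ≤ b_n ≤ μ^n` (`Zd.exp_mul_pow_le_bridgeCount`,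
`Zd.bridgeCount_le_pow`) and SUPERmultiplicativity `b_n b_m ≤ b_{n+m}` (`Zd.bridgeCount_mul_le`):

* `upper_dev_env` (real sequences): a deviation `φ_N ≥ μ² + u` forces `M log(1 + u/(2μ²)) ≤ c√N` for
  `M D ≤ uN/2`;
* `lower_dev_supermult` (real sequences): a deviation `φ_{N'+2M} ≤ μ² - u` forces
  `-M log(1 - u/(2μ²)) ≤ c √(2M)` for `2 M D ≤ u N'` (the mirror of `KestenRate.upper_dev_submult`);
* **`bridgeTwoStepRate (d) : ∃ K N₀, ∀ N ≥ N₀, -K N^{-1/3} ≤ b_{N+2}/b_N - μ² ≤ K N^{-1/4}`** on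
  `ℤ^{d+2}` — exactly the asymmetric exponents printed in (7.5.2), here for bridges.
-/

noncomputable section

open Filter Topology Finset Literature.Probability.LatticeModels Literature.Probability.Percolation SimpleGraph
open scoped BigOperators

namespace Literature.Probability.RandomPlanarGeometry.SAW.Zd

/-! ### The two deviation lemmas for real sequences -/

/-- **Upper deviation with the envelope**: if `φ_N ≥ μ² + u` (`N ≥ N₁`, `N ≥ 1`) and `M·D ≤ uN/2` then
`(μ² + u/2)^M b_N ≤ b_{N+2M} ≤ μ^{N+2M}` against `b_N ≥ e^{-c√N} μ^N`:
`M log(1 + u/(2μ²)) ≤ c√N`. [cite: MadrasSlade1993, Lemma 7.3.1 (proof, quantitative form)] -/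
theorem upper_dev_env {b : ℕ → ℝ} {μ D c u : ℝ} {N₁ N M : ℕ} (hb : ∀ n, 0 < b n) (hμ : 0 < μ)
    (hD : 0 ≤ D) (hK : ∀ n : ℕ, N₁ ≤ n → b (n + 2) / b n - D / n ≤ b (n + 4) / b (n + 2))
    (hhi : ∀ n : ℕ, b n ≤ μ ^ n) (hlo : Real.exp (-(c * Real.sqrt N)) * μ ^ N ≤ b N)
    (hN : N₁ ≤ N) (hN1 : 1 ≤ N) (hu : 0 < u) (hdev : μ ^ 2 + u ≤ b (N + 2) / b N)
    (hM : (M : ℝ) * D ≤ u * N / 2) :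
    (M : ℝ) * Real.log (1 + u / (2 * μ ^ 2)) ≤ c * Real.sqrt N := by
  have hN0 : (0 : ℝ) < N := by exact_mod_cast hN1
  set q : ℝ := μ ^ 2 + u / 2 with hq
  have hq0 : 0 ≤ q := by positivity
  have hK' : ∀ n : ℕ, N₁ ≤ n → (fun n => b (n + 2) / b n) n - D / n ≤ (fun n => b (n + 2) / b n) (n + 2) := by
    intro n hn; simpa [add_assoc] using hK n hn
  have hiter := kesten_iter_forward (φ := fun n => b (n + 2) / b n) (N₁ := N₁) hD hK' hN hN1
  have hstep : ∀ k < M, q ≤ b (N + 2 * k + 2) / b (N + 2 * k) := by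
    intro k hk
    have h1 := hiter k
    have h2 : (k : ℝ) * D / N ≤ u / 2 := by
      rw [div_le_iff₀ hN0]
      have : (k : ℝ) * D ≤ M * D := mul_le_mul_of_nonneg_right (by exact_mod_cast hk.le) hD
      linarith
    have e : b (N + 2 * k + 2) / b (N + 2 * k) = (fun n => b (n + 2) / b n) (N + 2 * k) := rfl
    rw [e]
    linarith
  have hprod := kesten_prod_ge hb (n := N) (M := M) hq0 hstep
  have h1 : q ^ M * (Real.exp (-(c * Real.sqrt N)) * μ ^ N) ≤ μ ^ (N + 2 * M) :=
    calc q ^ M * (Real.exp (-(c * Real.sqrt N)) * μ ^ N) ≤ q ^ M * b N :=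
          mul_le_mul_of_nonneg_left hlo (pow_nonneg hq0 M)
      _ ≤ b (N + 2 * M) := hprod
      _ ≤ μ ^ (N + 2 * M) := hhi _
  have h2 : (q / μ ^ 2) ^ M ≤ Real.exp (c * Real.sqrt N) := by
    rw [div_pow, div_le_iff₀ (by positivity), ← pow_mul]
    have e : μ ^ (N + 2 * M) = μ ^ (2 * M) * μ ^ N := by rw [pow_add, mul_comm]
    rw [e] at h1
    have h1' : q ^ M * Real.exp (-(c * Real.sqrt N)) * μ ^ N ≤ μ ^ (2 * M) * μ ^ N := by
      rw [mul_assoc]; exact h1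
    have h3 := le_of_mul_le_mul_right h1' (pow_pos hμ N)
    rw [Real.exp_neg] at h3
    rwa [← div_eq_mul_inv, div_le_iff₀ (Real.exp_pos _), mul_comm] at h3
  have hr : q / μ ^ 2 = 1 + u / (2 * μ ^ 2) := by rw [hq]; field_simp
  have hr0 : 0 < q / μ ^ 2 := by rw [hr]; positivity
  have h3 := Real.log_le_log (pow_pos hr0 M) h2
  rw [Real.log_exp, Real.log_pow, hr] at h3
  exact h3

/-- **Lower deviation with supermultiplicativity**: if `φ_{N'+2M} ≤ μ² - u` (`0 < u ≤ μ²`, `N' ≥ N₁`,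
`N' ≥ 1`) and `2 M D ≤ u N'` then backward iteration keeps `φ ≤ μ² - u/2` on `[N', N'+2M]`, so
`b_{N'} b_{2M} ≤ b_{N'+2M} ≤ (μ² - u/2)^M b_{N'}` against `b_{2M} ≥ e^{-c√(2M)} μ^{2M}`:
`-M log(1 - u/(2μ²)) ≤ c √(2M)`. [cite: MadrasSlade1993, Lemma 7.3.1 (proof, quantitative form)] -/
theorem lower_dev_supermult {b : ℕ → ℝ} {μ D c u : ℝ} {N₁ N' M : ℕ} (hb : ∀ n, 0 < b n) (hμ : 0 < μ)
    (hD : 0 ≤ D) (hK : ∀ n : ℕ, N₁ ≤ n → b (n + 2) / b n - D / n ≤ b (n + 4) / b (n + 2))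
    (hsup : ∀ n m : ℕ, b n * b m ≤ b (n + m))
    (hlo : Real.exp (-(c * Real.sqrt ((2 * M : ℕ) : ℝ))) * μ ^ (2 * M) ≤ b (2 * M))
    (hN' : N₁ ≤ N') (hN'1 : 1 ≤ N') (hu : 0 < u) (huμ : u ≤ μ ^ 2)
    (hdev : b (N' + 2 * M + 2) / b (N' + 2 * M) ≤ μ ^ 2 - u) (hM : 2 * (M : ℝ) * D ≤ u * N') :
    -((M : ℝ) * Real.log (1 - u / (2 * μ ^ 2))) ≤ c * Real.sqrt ((2 * M : ℕ) : ℝ) := by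
  have hN0 : (0 : ℝ) < N' := by exact_mod_cast hN'1
  set q : ℝ := μ ^ 2 - u / 2 with hq
  have hq0 : 0 < q := by rw [hq]; nlinarith
  have hK' : ∀ n : ℕ, N₁ ≤ n → (fun n => b (n + 2) / b n) n - D / n ≤ (fun n => b (n + 2) / b n) (n + 2) := by
    intro n hn; simpa [add_assoc] using hK n hn
  have hiter := kesten_iter_backward (φ := fun n => b (n + 2) / b n) (N₁ := N₁) hD hK'
  have hMD : (M : ℝ) * D / N' ≤ u / 2 := by
    rw [div_le_iff₀ hN0]; linarith
  have hstep : ∀ j < M, b (N' + 2 * j + 2) / b (N' + 2 * j) ≤ q := by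
    intro j hj
    have h1 := hiter (M - j) (N' + 2 * j) (by omega) (by omega)
    have e : N' + 2 * j + 2 * (M - j) = N' + 2 * M := by omega
    rw [e] at h1
    have h2 : ((M - j : ℕ) : ℝ) * D / ((N' + 2 * j : ℕ) : ℝ) ≤ M * D / N' := by
      have hMj : ((M - j : ℕ) : ℝ) ≤ M := by exact_mod_cast Nat.sub_le M j
      have hden : (N' : ℝ) ≤ ((N' + 2 * j : ℕ) : ℝ) := by exact_mod_cast Nat.le_add_right N' (2 * j)
      calc ((M - j : ℕ) : ℝ) * D / ((N' + 2 * j : ℕ) : ℝ) ≤ M * D / ((N' + 2 * j : ℕ) : ℝ) :=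
            div_le_div_of_nonneg_right (mul_le_mul_of_nonneg_right hMj hD) (by positivity)
        _ ≤ M * D / N' := div_le_div_of_nonneg_left (by positivity) hN0 hden
    have e1 : b (N' + 2 * j + 2) / b (N' + 2 * j) = (fun n => b (n + 2) / b n) (N' + 2 * j) := rfl
    have e2 : b (N' + 2 * M + 2) / b (N' + 2 * M) = (fun n => b (n + 2) / b n) (N' + 2 * M) := rfl
    rw [e1]; rw [e2] at hdev
    linarith
  have hprod := kesten_prod_le hb (n := N') (M := M) hstep
  -- `b_{N'} e^{-c√(2M)} μ^{2M} ≤ b_{N'} b_{2M} ≤ b_{N'+2M} ≤ q^M b_{N'}`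
  have h1 : b N' * (Real.exp (-(c * Real.sqrt ((2 * M : ℕ) : ℝ))) * μ ^ (2 * M)) ≤ q ^ M * b N' :=
    calc b N' * (Real.exp (-(c * Real.sqrt ((2 * M : ℕ) : ℝ))) * μ ^ (2 * M)) ≤ b N' * b (2 * M) :=
          mul_le_mul_of_nonneg_left hlo (hb N').le
      _ ≤ b (N' + 2 * M) := hsup N' (2 * M)
      _ ≤ q ^ M * b N' := hprod
  have h2 : Real.exp (-(c * Real.sqrt ((2 * M : ℕ) : ℝ))) ≤ (q / μ ^ 2) ^ M := by
    rw [div_pow, ← pow_mul, le_div_iff₀ (by positivity)]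
    have h1' : Real.exp (-(c * Real.sqrt ((2 * M : ℕ) : ℝ))) * μ ^ (2 * M) * b N' ≤ q ^ M * b N' := by
      rw [mul_comm] at h1; simpa [mul_assoc, mul_comm, mul_left_comm] using h1
    exact le_of_mul_le_mul_right h1' (hb N')
  have hr : q / μ ^ 2 = 1 - u / (2 * μ ^ 2) := by rw [hq]; field_simp
  have hr0 : 0 < q / μ ^ 2 := by positivity
  have h3 := Real.log_le_log (Real.exp_pos _) h2
  rw [Real.log_exp, Real.log_pow, hr] at h3
  linarith

/-! ### The two rate routines for real sequences -/

/-- `-log(1 - x) ≥ x` for `x < 1`. [folklore] -/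
private theorem le_neg_log_one_sub {x : ℝ} (hx : x < 1) : x ≤ -Real.log (1 - x) := by
  have h := Real.add_one_le_exp (-x)
  have h1 : 0 < 1 - x := by linarith
  have h2 := Real.log_le_log h1 (by linarith : 1 - x ≤ Real.exp (-x))
  rw [Real.log_exp] at h2; linarith

/-- `log(1 + x) ≥ x/2` on `[0, 1]`. [folklore] -/
private theorem half_le_log_one_add {x : ℝ} (hx0 : 0 ≤ x) (hx1 : x ≤ 1) : x / 2 ≤ Real.log (1 + x) := by
  have h := Real.add_one_le_exp (-(Real.log (1 + x)))
  rw [Real.exp_neg, Real.exp_log (by linarith)] at h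
  have h1 : x / (1 + x) ≤ Real.log (1 + x) := by
    rw [div_le_iff₀ (by linarith)]
    have : (1 - Real.log (1 + x)) * (1 + x) ≤ 1 := by
      calc (1 - Real.log (1 + x)) * (1 + x) = (-Real.log (1 + x) + 1) * (1 + x) := by ring
        _ ≤ (1 + x)⁻¹ * (1 + x) := mul_le_mul_of_nonneg_right h (by linarith)
        _ = 1 := inv_mul_cancel₀ (by linarith)
    nlinarith
  have h2 : x / 2 ≤ x / (1 + x) := div_le_div_of_nonneg_left hx0 (by linarith) (by linarith)
  linarith

/-- **Lower routine**: a deviation `φ_N ≤ μ² - v` with `0 < v ≤ min(μ², D)` at `N ≥ 2N₁ + 2` forces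
`v³ N ≤ 32 c² μ⁴ D + 4 D³`. [cite: MadrasSlade1993, Lemma 7.3.1 (proof, quantitative form)] -/
theorem lower_rate_core {b : ℕ → ℝ} {μ D c v : ℝ} {N₁ N : ℕ} (hb : ∀ n, 0 < b n) (hμ : 0 < μ)
    (hD1 : 1 ≤ D)
    (hK : ∀ n : ℕ, N₁ ≤ n → b (n + 2) / b n - D / n ≤ b (n + 4) / b (n + 2))
    (hsup : ∀ n m : ℕ, b n * b m ≤ b (n + m))
    (hlo : ∀ n : ℕ, Real.exp (-(c * Real.sqrt n)) * μ ^ n ≤ b n)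
    (hN : 2 * N₁ + 2 ≤ N) (hv : 0 < v) (hvμ : v ≤ μ ^ 2) (hvD : v ≤ D)
    (hdev : b (N + 2) / b N ≤ μ ^ 2 - v) : v ^ 3 * N ≤ 32 * c ^ 2 * μ ^ 4 * D + 4 * D ^ 3 := by
  have hD : 0 ≤ D := by linarith
  have hD0 : 0 < D := by linarith
  have hN0 : (0 : ℝ) < N := by exact_mod_cast (show 0 < N by omega)
  obtain ⟨M, hMdef⟩ : ∃ M : ℕ, M = Nat.floor (v * N / (4 * D)) := ⟨_, rfl⟩
  have hMle : (M : ℝ) ≤ v * N / (4 * D) := by rw [hMdef]; exact Nat.floor_le (by positivity)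
  have hMge : v * N / (4 * D) - 1 ≤ M := by
    have := Nat.lt_floor_add_one (v * N / (4 * D)); rw [← hMdef] at this; linarith
  have hM4 : 4 * (M : ℝ) ≤ N := by
    have h1 : v * N / (4 * D) ≤ N / 4 := by
      rw [div_le_div_iff₀ (by positivity) (by norm_num)]; nlinarith
    linarith
  have hM4' : 4 * M ≤ N := by exact_mod_cast hM4
  obtain ⟨N', hN'def⟩ : ∃ N' : ℕ, N' = N - 2 * M := ⟨_, rfl⟩
  have hN'eq : N' + 2 * M = N := by omega
  have hN'ge : N₁ ≤ N' := by omega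
  have hN'1 : 1 ≤ N' := by omega
  have hN'half : (N : ℝ) ≤ 2 * N' := by exact_mod_cast (show N ≤ 2 * N' by omega)
  have hdev' : b (N' + 2 * M + 2) / b (N' + 2 * M) ≤ μ ^ 2 - v := by rw [hN'eq]; exact hdev
  have hMD : 2 * (M : ℝ) * D ≤ v * N' := by
    have h1 : (M : ℝ) * (4 * D) ≤ v * N := by rwa [le_div_iff₀ (by positivity)] at hMle
    nlinarith
  have hlem := lower_dev_supermult (N₁ := N₁) hb hμ hD hK hsup (hlo (2 * M)) hN'ge hN'1 hv hvμ hdev' hMD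
  -- `x = v/(2μ²) ≤ 1/2`, `M x ≤ c √(2M)`, `M x² ≤ 2 c²`
  obtain ⟨x, hx⟩ : ∃ x : ℝ, x = v / (2 * μ ^ 2) := ⟨_, rfl⟩
  have hx0 : 0 < x := by rw [hx]; positivity
  have hx1 : x ≤ 1 / 2 := by rw [hx, div_le_div_iff₀ (by positivity) (by norm_num)]; nlinarith
  have hMx : (M : ℝ) * x ≤ c * Real.sqrt ((2 * M : ℕ) : ℝ) := by
    have h1 := mul_le_mul_of_nonneg_left (le_neg_log_one_sub (show x < 1 by linarith)) (Nat.cast_nonneg M)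
    rw [hx] at h1 ⊢
    linarith
  have hM2 : (M : ℝ) * x ^ 2 ≤ 2 * c ^ 2 := by
    rcases Nat.eq_zero_or_pos M with hM0 | hMpos
    · rw [hM0, Nat.cast_zero, zero_mul]; positivity
    have hMr : (0 : ℝ) < M := by exact_mod_cast hMpos
    have hsq : ((M : ℝ) * x) ^ 2 ≤ (c * Real.sqrt ((2 * M : ℕ) : ℝ)) ^ 2 :=
      pow_le_pow_left₀ (by positivity) hMx 2
    rw [mul_pow, mul_pow, Real.sq_sqrt (by positivity)] at hsq
    push_cast at hsq
    nlinarith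
  have hxμ : x * (2 * μ ^ 2) = v := by rw [hx]; exact div_mul_cancel₀ _ (by positivity)
  have e : (M : ℝ) * x ^ 2 * (4 * μ ^ 4) = M * v ^ 2 := by
    linear_combination ((M : ℝ) * (x * (2 * μ ^ 2) + v)) * hxμ
  have hM2' : (M : ℝ) * v ^ 2 ≤ 8 * c ^ 2 * μ ^ 4 := by
    have := mul_le_mul_of_nonneg_right hM2 (show (0:ℝ) ≤ 4 * μ ^ 4 by positivity)
    rw [e] at this; linarith
  have h3 : (v * N / (4 * D) - 1) * v ^ 2 ≤ 8 * c ^ 2 * μ ^ 4 := by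
    have := mul_le_mul_of_nonneg_right hMge (sq_nonneg v); linarith
  have hd4 : v * N / (4 * D) * (4 * D) = v * N := div_mul_cancel₀ _ (by positivity)
  have e2 : (v * N / (4 * D) - 1) * v ^ 2 * (4 * D) = v ^ 3 * N - 4 * D * v ^ 2 := by
    linear_combination (v ^ 2) * hd4
  have h4 : v ^ 3 * N - 4 * D * v ^ 2 ≤ 8 * c ^ 2 * μ ^ 4 * (4 * D) := by
    have := mul_le_mul_of_nonneg_right h3 (show (0:ℝ) ≤ 4 * D by positivity)
    rwa [e2] at this
  have h5 : 4 * D * v ^ 2 ≤ 4 * D ^ 3 := by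
    have := pow_le_pow_left₀ hv.le hvD 2; nlinarith
  linarith

/-- **Upper routine**: a deviation `φ_N ≥ μ² + u` (`u > 0`, `N ≥ max(N₁, 1)`) forces
`u · N^{1/4} ≤ √(8 μ² D (c+1)) + 2D(2c+1)`. [cite: MadrasSlade1993, Lemma 7.3.1 (proof, quantitative form)] -/
theorem upper_rate_core {b : ℕ → ℝ} {μ D c u : ℝ} {N₁ N : ℕ} (hb : ∀ n, 0 < b n) (hμ : 0 < μ)
    (hD1 : 1 ≤ D) (hc0 : 0 ≤ c)
    (hK : ∀ n : ℕ, N₁ ≤ n → b (n + 2) / b n - D / n ≤ b (n + 4) / b (n + 2))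
    (hhi : ∀ n : ℕ, b n ≤ μ ^ n) (hlo : ∀ n : ℕ, Real.exp (-(c * Real.sqrt n)) * μ ^ n ≤ b n)
    (hN : N₁ ≤ N) (hN1 : 1 ≤ N) (hu : 0 < u) (hdev : μ ^ 2 + u ≤ b (N + 2) / b N) :
    u * (N : ℝ) ^ ((1 : ℝ) / 4) ≤ Real.sqrt (8 * μ ^ 2 * D * (c + 1)) + 2 * D * (2 * c + 1) := by
  have hD : 0 ≤ D := by linarith
  have hD0 : 0 < D := by linarith
  have hNr : (1 : ℝ) ≤ N := by exact_mod_cast hN1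
  have hN0 : (0 : ℝ) < N := by linarith
  obtain ⟨M, hMdef⟩ : ∃ M : ℕ, M = Nat.floor (u * N / (2 * D)) := ⟨_, rfl⟩
  have hMle : (M : ℝ) ≤ u * N / (2 * D) := by rw [hMdef]; exact Nat.floor_le (by positivity)
  have hMge : u * N / (2 * D) - 1 ≤ M := by
    have := Nat.lt_floor_add_one (u * N / (2 * D)); rw [← hMdef] at this; linarith
  have hMD : (M : ℝ) * D ≤ u * N / 2 := by
    have h1 : (M : ℝ) * (2 * D) ≤ u * N := by rwa [le_div_iff₀ (by positivity)] at hMle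
    linarith
  have hlem := upper_dev_env (N₁ := N₁) hb hμ hD hK hhi (hlo N) hN hN1 hu hdev hMD
  obtain ⟨x, hx⟩ : ∃ x : ℝ, x = u / (2 * μ ^ 2) := ⟨_, rfl⟩
  have hx0 : 0 < x := by rw [hx]; positivity
  rw [← hx] at hlem
  -- `t = N^{1/4}`, `t² = √N ≥ 1`
  obtain ⟨t, ht⟩ : ∃ t : ℝ, t = (N : ℝ) ^ ((1 : ℝ) / 4) := ⟨_, rfl⟩
  have ht0 : 0 < t := by rw [ht]; exact Real.rpow_pos_of_pos hN0 _
  have ht1 : 1 ≤ t := by rw [ht]; exact Real.one_le_rpow hNr (by norm_num)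
  have ht2 : t ^ 2 = Real.sqrt N := by
    rw [ht, ← Real.rpow_natCast, ← Real.rpow_mul hN0.le, Real.sqrt_eq_rpow]; norm_num
  have hsN0 : 0 < Real.sqrt N := Real.sqrt_pos.2 hN0
  have hNsq : (N : ℝ) = Real.sqrt N * Real.sqrt N := (Real.mul_self_sqrt hN0.le).symm
  rw [← ht]
  by_cases hx1 : 1 ≤ x
  · -- large deviation
    have hlog2 : (1 : ℝ) / 2 ≤ Real.log (1 + x) := by
      have h1 : Real.log 2 ≤ Real.log (1 + x) := Real.log_le_log (by norm_num) (by linarith)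
      have h2 : (1 : ℝ) / 2 ≤ Real.log 2 := by have := Real.log_two_gt_d9; linarith
      linarith
    have hM2 : (M : ℝ) ≤ 2 * c * Real.sqrt N := by
      have := mul_le_mul_of_nonneg_left hlog2 (Nat.cast_nonneg M)
      nlinarith [hlem, Real.sqrt_nonneg (N : ℝ)]
    have h3 : u * N ≤ 2 * D * (2 * c + 1) * Real.sqrt N := by
      have h1 : u * N / (2 * D) ≤ (2 * c + 1) * Real.sqrt N := by nlinarith
      rw [div_le_iff₀ (by positivity)] at h1
      linarith
    have h4 : u * Real.sqrt N ≤ 2 * D * (2 * c + 1) := by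
      refine le_of_mul_le_mul_right ?_ hsN0
      rw [mul_assoc, Real.mul_self_sqrt hN0.le]; exact h3
    have h5 : u * t ≤ u * Real.sqrt N := by
      rw [← ht2]; exact mul_le_mul_of_nonneg_left (by nlinarith) hu.le
    have h6 : 0 ≤ Real.sqrt (8 * μ ^ 2 * D * (c + 1)) := Real.sqrt_nonneg _
    exact h5.trans (h4.trans (le_add_of_nonneg_left h6))
  · -- small deviation
    rw [not_le] at hx1
    have hlogx := half_le_log_one_add hx0.le hx1.le
    have hMx : (M : ℝ) * x ≤ 2 * c * Real.sqrt N := by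
      have := mul_le_mul_of_nonneg_left hlogx (Nat.cast_nonneg M)
      nlinarith [hlem, Real.sqrt_nonneg (N : ℝ)]
    have h3 : (u * N / (2 * D) - 1) * x ≤ 2 * c * Real.sqrt N := by
      have := mul_le_mul_of_nonneg_right hMge hx0.le; linarith
    have hd1 : u * N / (2 * D) * (2 * D) = u * N := div_mul_cancel₀ _ (by positivity)
    have hd2 : x * (2 * μ ^ 2) = u := by rw [hx]; exact div_mul_cancel₀ _ (by positivity)
    have e2 : (u * N / (2 * D) - 1) * x * (4 * μ ^ 2 * D) = u ^ 2 * N - 4 * μ ^ 2 * D * x := by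
      linear_combination (2 * μ ^ 2 * x) * hd1 + (u * N) * hd2
    have h4 : u ^ 2 * N - 4 * μ ^ 2 * D * x ≤ 2 * c * Real.sqrt N * (4 * μ ^ 2 * D) := by
      have := mul_le_mul_of_nonneg_right h3 (show (0:ℝ) ≤ 4 * μ ^ 2 * D by positivity)
      rwa [e2] at this
    have h5 : 4 * μ ^ 2 * D * x ≤ 8 * μ ^ 2 * D * Real.sqrt N := by
      have hsN1 : 1 ≤ Real.sqrt N := by rw [← ht2]; exact one_le_pow₀ ht1
      have : x ≤ 2 * Real.sqrt N := by linarith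
      have h0 : 0 ≤ 4 * μ ^ 2 * D := by positivity
      calc 4 * μ ^ 2 * D * x ≤ 4 * μ ^ 2 * D * (2 * Real.sqrt N) := mul_le_mul_of_nonneg_left this h0
        _ = 8 * μ ^ 2 * D * Real.sqrt N := by ring
    have h7 : u ^ 2 * N ≤ 8 * μ ^ 2 * D * (c + 1) * Real.sqrt N := by linarith
    have h6 : u ^ 2 * Real.sqrt N ≤ 8 * μ ^ 2 * D * (c + 1) := by
      refine le_of_mul_le_mul_right ?_ hsN0
      rw [mul_assoc, Real.mul_self_sqrt hN0.le]; exact h7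
    have h8 : (u * t) ^ 2 ≤ 8 * μ ^ 2 * D * (c + 1) := by rw [mul_pow, ht2]; exact h6
    have h9 : u * t ≤ Real.sqrt (8 * μ ^ 2 * D * (c + 1)) :=
      (Real.le_sqrt (by positivity) (by positivity)).2 h8
    have h10 : 0 ≤ 2 * D * (2 * c + 1) := by positivity
    exact h9.trans (le_add_of_nonneg_right h10)

/-! ### The rate for bridges -/

section Bridges

variable (d : ℕ)

/-- The bridge data in Kesten's form: `∃ D ≥ 1, N₁` with `φ_n - D/n ≤ φ_{n+2}` for `n ≥ N₁`
(from `MadrasSlade1993_thm732b` and `φ_n ≥ 1`). [cite: MadrasSlade1993, Theorem 7.3.2(b)] -/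
theorem bridges_kesten_additive : ∃ D : ℝ, 1 ≤ D ∧ ∃ N₁ : ℕ, ∀ n : ℕ, N₁ ≤ n →
    (bridgeCount (d + 2) (n + 2) : ℝ) / bridgeCount (d + 2) n - D / n ≤
      (bridgeCount (d + 2) (n + 4) : ℝ) / bridgeCount (d + 2) (n + 2) := by
  obtain ⟨D, hD⟩ := MadrasSlade1993_thm732b d
  obtain ⟨N₁, hN₁⟩ := eventually_atTop.1 hD
  refine ⟨max D 1, le_max_right _ _, max N₁ 1, fun n hn => ?_⟩
  have hn1 : 1 ≤ n := le_trans (le_max_right _ _) hn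
  have h := hN₁ n (le_trans (le_max_left _ _) hn)
  have hb0 : ∀ m, (0 : ℝ) < bridgeCount (d + 2) m := fun m => by exact_mod_cast one_le_bridgeCount (d := d + 2) m
  obtain ⟨φ, hφ⟩ : ∃ φ : ℝ, φ = (bridgeCount (d + 2) (n + 2) : ℝ) / bridgeCount (d + 2) n := ⟨_, rfl⟩
  obtain ⟨φ', hφ'⟩ : ∃ φ' : ℝ, φ' = (bridgeCount (d + 2) (n + 4) : ℝ) / bridgeCount (d + 2) (n + 2) := ⟨_, rfl⟩
  rw [← hφ, ← hφ'] at h ⊢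
  have hφ1 : 1 ≤ φ := by
    rw [hφ, le_div_iff₀ (hb0 n), one_mul]; exact_mod_cast bridgeCount_le_add_two (d' := d + 2) n
  have hn' : (0 : ℝ) < n := by exact_mod_cast hn1
  have h1 : φ * (φ - φ') ≤ D / n := by nlinarith
  have h2 : φ - φ' ≤ max D 1 / n := by
    by_cases hcase : φ - φ' ≤ 0
    · exact hcase.trans (by positivity)
    · rw [not_le] at hcase
      have : φ - φ' ≤ φ * (φ - φ') := by nlinarith
      calc φ - φ' ≤ D / n := this.trans h1
        _ ≤ max D 1 / n := div_le_div_of_nonneg_right (le_max_left _ _) hn'.le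
  linarith

/-- **Kesten-type rate for (7.3.13), every dimension `d + 2 ≥ 2`**: there are `K` and `N₀` with
`-K N^{-1/3} ≤ b_{N+2}/b_N - μ² ≤ K N^{-1/4}` for all `N ≥ N₀` (the asymmetric exponents of Kesten's
(7.5.2), for bridges; the printed (7.3.13) has no rate). [cite: MadrasSlade1993, Theorem 7.3.4(d), eq. (7.3.13); §7.5 eq. (7.5.2)] -/
theorem bridgeTwoStepRate : ∃ K : ℝ, ∃ N₀ : ℕ, ∀ N : ℕ, N₀ ≤ N →
    -K * (N : ℝ) ^ (-(1 : ℝ) / 3) ≤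
        (bridgeCount (d + 2) (N + 2) : ℝ) / bridgeCount (d + 2) N - connectiveConstant (d + 2) ^ 2 ∧
      (bridgeCount (d + 2) (N + 2) : ℝ) / bridgeCount (d + 2) N - connectiveConstant (d + 2) ^ 2 ≤
        K * (N : ℝ) ^ (-(1 : ℝ) / 4) := by
  obtain ⟨μ, hμdef⟩ : ∃ μ : ℝ, μ = connectiveConstant (d + 2) := ⟨_, rfl⟩
  have hμ : 0 < μ := by rw [hμdef]; exact connectiveConstant_pos (d + 2)
  have hb : ∀ n, (0 : ℝ) < (bridgeCount (d + 2) n : ℝ) := fun n => by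
    exact_mod_cast one_le_bridgeCount (d := d + 2) n
  obtain ⟨D, hD1, N₁, hK⟩ := bridges_kesten_additive d
  obtain ⟨c₀, hc₀⟩ := exp_mul_pow_le_bridgeCount (d := d + 2)
  obtain ⟨c, hcdef⟩ : ∃ c : ℝ, c = max c₀ 0 := ⟨_, rfl⟩
  have hc0 : 0 ≤ c := by rw [hcdef]; exact le_max_right _ _
  have hlo : ∀ n : ℕ, Real.exp (-(c * Real.sqrt n)) * μ ^ n ≤ (bridgeCount (d + 2) n : ℝ) := by
    intro n
    rw [hμdef]
    refine le_trans (mul_le_mul_of_nonneg_right ?_ (pow_nonneg (connectiveConstant_pos (d + 2)).le n)) (hc₀ n)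
    exact Real.exp_le_exp.2 (neg_le_neg (mul_le_mul_of_nonneg_right (by rw [hcdef]; exact le_max_left _ _)
      (Real.sqrt_nonneg _)))
  have hhi : ∀ n : ℕ, (bridgeCount (d + 2) n : ℝ) ≤ μ ^ n := fun n => by
    rw [hμdef]; exact bridgeCount_le_pow (d := d + 2) n
  have hsup : ∀ n m : ℕ, (bridgeCount (d + 2) n : ℝ) * (bridgeCount (d + 2) m : ℝ) ≤
      (bridgeCount (d + 2) (n + m) : ℝ) := fun n m => by
    exact_mod_cast bridgeCount_mul_le (d := d + 2) n m
  have hone : ∀ n, (1 : ℝ) ≤ (bridgeCount (d + 2) (n + 2) : ℝ) / bridgeCount (d + 2) n := fun n => by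
    rw [le_div_iff₀ (hb n), one_mul]; exact_mod_cast bridgeCount_le_add_two (d' := d + 2) n
  -- constants
  obtain ⟨A, hA⟩ : ∃ A : ℝ, A = 32 * c ^ 2 * μ ^ 4 * D + 4 * D ^ 3 := ⟨_, rfl⟩
  have hA0 : 0 < A := by rw [hA]; positivity
  have hD0 : 0 < D := by linarith
  obtain ⟨Kup, hKup⟩ : ∃ K : ℝ, K = Real.sqrt (8 * μ ^ 2 * D * (c + 1)) + 2 * D * (2 * c + 1) := ⟨_, rfl⟩
  have hKup0 : 0 ≤ Kup := by rw [hKup]; positivity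
  obtain ⟨Klo, hKlo⟩ : ∃ K : ℝ, K = A ^ ((1 : ℝ) / 3) := ⟨_, rfl⟩
  have hKlo0 : 0 ≤ Klo := by rw [hKlo]; positivity
  refine ⟨Kup + Klo, 2 * N₁ + 2 + (Nat.ceil (A / D ^ 3) + 1), fun N hN => ?_⟩
  have hNN₁ : N₁ ≤ N := by omega
  have hN1 : 1 ≤ N := by omega
  have hNr : (1 : ℝ) ≤ N := by exact_mod_cast hN1
  have hN0 : (0 : ℝ) < N := by linarith
  obtain ⟨φ, hφ⟩ : ∃ φ : ℝ, φ = (bridgeCount (d + 2) (N + 2) : ℝ) / bridgeCount (d + 2) N := ⟨_, rfl⟩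
  rw [← hφ, ← hμdef]
  have hφ1 : 1 ≤ φ := by rw [hφ]; exact hone N
  have hr3 : 0 ≤ (N : ℝ) ^ (-(1 : ℝ) / 3) := by positivity
  have hr4 : 0 ≤ (N : ℝ) ^ (-(1 : ℝ) / 4) := by positivity
  constructor
  · -- lower side
    by_cases hupos : μ ^ 2 - φ ≤ 0
    · nlinarith
    rw [not_le] at hupos
    have core : ∀ v : ℝ, 0 < v → v ≤ μ ^ 2 - φ → v ≤ D → v ^ 3 * N ≤ A := by
      intro v hv hvu hvD
      rw [hA]
      refine lower_rate_core (b := fun n => (bridgeCount (d + 2) n : ℝ)) (N₁ := N₁) hb hμ hD1 hK hsup hlo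
        (by omega) hv ?_ hvD ?_
      · linarith
      · show (bridgeCount (d + 2) (N + 2) : ℝ) / bridgeCount (d + 2) N ≤ μ ^ 2 - v
        rw [← hφ]; linarith
    have huD : μ ^ 2 - φ ≤ D := by
      by_contra hgt
      rw [not_le] at hgt
      have h := core D hD0 hgt.le le_rfl
      have hN' : A / D ^ 3 < N := by
        have h1 : (Nat.ceil (A / D ^ 3) : ℝ) < N := by
          have : Nat.ceil (A / D ^ 3) + 1 ≤ N := by omega
          exact_mod_cast this
        exact (Nat.le_ceil _).trans_lt h1
      rw [div_lt_iff₀ (by positivity)] at hN'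
      linarith
    have hmain := core (μ ^ 2 - φ) hupos le_rfl huD
    have hKN : μ ^ 2 - φ ≤ Klo * (N : ℝ) ^ (-(1 : ℝ) / 3) := by
      have h1 : (μ ^ 2 - φ) ^ 3 ≤ A / N := by rw [le_div_iff₀ hN0]; linarith
      have h2 : μ ^ 2 - φ = ((μ ^ 2 - φ) ^ 3) ^ ((1 : ℝ) / 3) := by
        rw [one_div, show (3 : ℝ) = ((3 : ℕ) : ℝ) by norm_num, Real.pow_rpow_inv_natCast hupos.le (by norm_num)]
      rw [h2]
      calc ((μ ^ 2 - φ) ^ 3) ^ ((1 : ℝ) / 3) ≤ (A / N) ^ ((1 : ℝ) / 3) :=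
            Real.rpow_le_rpow (by positivity) h1 (by norm_num)
        _ = Klo * (N : ℝ) ^ (-(1 : ℝ) / 3) := by
            rw [hKlo, Real.div_rpow hA0.le hN0.le, div_eq_mul_inv, ← Real.rpow_neg hN0.le]
            norm_num
    nlinarith
  · -- upper side
    by_cases hupos : φ - μ ^ 2 ≤ 0
    · nlinarith
    rw [not_le] at hupos
    have hdev : μ ^ 2 + (φ - μ ^ 2) ≤ (bridgeCount (d + 2) (N + 2) : ℝ) / bridgeCount (d + 2) N := by
      rw [← hφ]; linarith
    have hut := upper_rate_core (b := fun n => (bridgeCount (d + 2) n : ℝ)) (N₁ := N₁) hb hμ hD1 hc0 hK hhi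
      hlo hNN₁ hN1 hupos hdev
    rw [← hKup] at hut
    have ht0 : 0 < (N : ℝ) ^ ((1 : ℝ) / 4) := Real.rpow_pos_of_pos hN0 _
    have e : (N : ℝ) ^ (-(1 : ℝ) / 4) = ((N : ℝ) ^ ((1 : ℝ) / 4))⁻¹ := by
      rw [← Real.rpow_neg hN0.le]; norm_num
    rw [e]
    rw [← le_div_iff₀ ht0, div_eq_mul_inv] at hut
    have : Kup * ((N : ℝ) ^ ((1 : ℝ) / 4))⁻¹ ≤ (Kup + Klo) * ((N : ℝ) ^ ((1 : ℝ) / 4))⁻¹ :=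
      mul_le_mul_of_nonneg_right (by linarith) (inv_nonneg.2 ht0.le)
    linarith

/-- The target shape `BridgeTwoStepRate d K N₀` (ROUTES-G5 §R19, body verbatim): for `N ≥ N₀`,
`-K N^{-1/3} ≤ b_{N+2}/b_N - μ² ≤ K N^{-1/4}` on `ℤ^{d+2}`. [cite: MadrasSlade1993, Theorem 7.3.4(d), eq. (7.3.13)] -/
def BridgeTwoStepRate (K : ℝ) (N₀ : ℕ) : Prop :=
  ∀ N : ℕ, N₀ ≤ N →
    -K * (N : ℝ) ^ (-(1 : ℝ) / 3) ≤
        (bridgeCount (d + 2) (N + 2) : ℝ) / bridgeCount (d + 2) N - connectiveConstant (d + 2) ^ 2 ∧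
      (bridgeCount (d + 2) (N + 2) : ℝ) / bridgeCount (d + 2) N - connectiveConstant (d + 2) ^ 2 ≤
        K * (N : ℝ) ^ (-(1 : ℝ) / 4)

/-- The upper half in multiplicative form, `BridgeTwoStepUpperRate d K N₀` (ROUTES-G5 §R19, body verbatim):
`b_{N+2}/b_N ≤ μ² (1 + K N^{-1/4})` for `N ≥ N₀`. [cite: MadrasSlade1993, Theorem 7.3.4(d), eq. (7.3.13)] -/
def BridgeTwoStepUpperRate (K : ℝ) (N₀ : ℕ) : Prop :=
  ∀ N : ℕ, N₀ ≤ N →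
    (bridgeCount (d + 2) (N + 2) : ℝ) / bridgeCount (d + 2) N ≤
      connectiveConstant (d + 2) ^ 2 * (1 + K * (N : ℝ) ^ (-(1 : ℝ) / 4))

/-- **R19**: `∃ K N₀, BridgeTwoStepRate d K N₀`, with `K ≥ 0`. [cite: MadrasSlade1993, Theorem 7.3.4(d), eq. (7.3.13); §7.5 eq. (7.5.2)] -/
theorem exists_bridgeTwoStepRate : ∃ K : ℝ, 0 ≤ K ∧ ∃ N₀ : ℕ, BridgeTwoStepRate d K N₀ := by
  obtain ⟨K, N₀, h⟩ := bridgeTwoStepRate d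
  refine ⟨max K 0, le_max_right _ _, N₀, fun N hN => ?_⟩
  obtain ⟨h1, h2⟩ := h N hN
  have hr3 : 0 ≤ (N : ℝ) ^ (-(1 : ℝ) / 3) := by positivity
  have hr4 : 0 ≤ (N : ℝ) ^ (-(1 : ℝ) / 4) := by positivity
  have hK : K ≤ max K 0 := le_max_left _ _
  constructor
  · nlinarith
  · nlinarith

/-- **R19, upper half, multiplicative form**: `∃ K ≥ 0, ∃ N₀, BridgeTwoStepUpperRate d K N₀`
(from `b_{N+2}/b_N ≤ μ² + K N^{-1/4} ≤ μ²(1 + K N^{-1/4})` as `μ ≥ 1`). [cite: MadrasSlade1993, Theorem 7.3.4(d), eq. (7.3.13)] -/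
theorem exists_bridgeTwoStepUpperRate : ∃ K : ℝ, 0 ≤ K ∧ ∃ N₀ : ℕ, BridgeTwoStepUpperRate d K N₀ := by
  obtain ⟨K, hK0, N₀, h⟩ := exists_bridgeTwoStepRate d
  refine ⟨K, hK0, N₀, fun N hN => ?_⟩
  have h2 := (h N hN).2
  have hμ1 : 1 ≤ connectiveConstant (d + 2) := one_le_connectiveConstant (d + 2)
  have hμ2 : 1 ≤ connectiveConstant (d + 2) ^ 2 := one_le_pow₀ hμ1
  have hr4 : 0 ≤ K * (N : ℝ) ^ (-(1 : ℝ) / 4) := by positivity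
  nlinarith

end Bridges

end Literature.Probability.RandomPlanarGeometry.SAW.Zd
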